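import Summits.CriticalPhenomena.PercolationContinuityZ3.Theorems.PercAnnulusCrossingIICOneEnded
import Summits.CriticalPhenomena.PercolationContinuityZ3.Theorems.PercAnnulusCrossingIICMeasureCorollaries
import Summits.CriticalPhenomena.PercolationContinuityZ3.Theorems.PercAnnulusCrossingIICPlanarKesten
import Literature.Probability.Percolation.HarrisTheorem
import HarnessLib

/-!
# The IIC is one-ended, IV: packaged forms — `ℤ^d` at `p_c` under (A2)□, the printed (A2)_ρ, `ℤ³`, and `ℤ²` unconditionally
(lane RSW3, p1 gen 7)

builds on p205010 (kernel theorem, internal audit signed; external expert review pending) — used ONLY by the `p_c(ℤ^d)`, `d ≥ 2`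
statements below (through `CSH.percolationContinuity_allDimensions`); the `ℤ²` statements use Harris' theorem `θ(1/2) = 0`
(`harris_theta_half_holds`) and Kesten's `p_c(ℤ²) = 1/2` instead.

Seat `prim-rsw3-p1` (gen 7).  Corollaries of `iicMeasure_ae_numInfiniteClusters_sdiff_finset_eq_one`
(`PercAnnulusCrossingIICOneEnded.lean`): Kesten's IIC measure `ν` is carried by configurations whose unique infinite cluster is
ONE-ENDED — for every finite edge set `S`, `ω ∖ S` has exactly one infinite cluster.

* `exists_iicMeasure_oneEnded_of_setToSetQuasiMultAspectAt` — `d ≥ 1`, `0 < p`, `θ(p) = 0`, (A2)□ at aspect `(s,L)`, `s ≥ 2`;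
* `exists_iicMeasure_oneEnded_criticalProbI_of_setToSetQuasiMultAspectAt` — at `p_c(ℤ^d)`, `d ≥ 2`;
* `exists_iicMeasure_oneEnded_criticalProbI_of_basuSapozhnikovQM` — from the PRINTED hypothesis (A2)_ρ of Basu–Sapozhnikov;
* `exists_iicMeasure_oneEnded_of_setToSetQuasiMult` — `ℤ³` named form (`Crossing.SetToSetQuasiMult`);
* **`iicMeasure_ae_oneEnded_Z2`**, **`exists_iicMeasure_oneEnded_Z2`** — bond percolation on `ℤ²` at `p_c = 1/2`, NO hypothesis:
  Kesten's IIC (both constructions, p1 gen 6) has almost surely exactly one infinite cluster, and it has one end.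

Helper file for the crux `stmt-CriticalPhenomena-4575` chain; no definitions, no sorries.
References: H. Kesten, PTRF 73 (1986), Thm. (3); D. Basu, A. Sapozhnikov, ECP 22 (2017) no. 26, Thm. 1.1; R. van der Hofstad,
A. Járai, J. Stat. Phys. 114 (2004) 625–663, §1.3; M. Heydenreich, R. van der Hofstad (2017), §12.2.
-/

noncomputable section

namespace Summit.CriticalPhenomena.PercolationContinuityZ3.Theorems.Crossing

open MeasureTheory ProbabilityTheory Filter Topology
open Literature.Probability.Percolation Literature.Probability.LatticeModels
open Literature.Probability.Percolation.DCT16 Literature.Probability.Percolation.DKT20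
open Summit.CriticalPhenomena.PercolationContinuityZ3.Theorems.SurfaceTension
open scoped ENNReal ProbabilityTheory Literature.Probability.Percolation

variable {d : ℕ}

/-! ## `ℤ^d` under (A2)□ at aspect `(s, L)` -/

/-- **Kesten's IIC exists and is one-ended under (A2)□ at aspect `(s,L)`** (`d ≥ 1`, `0 < p`, `θ(p) = 0`, `s ≥ 2`, `ϰ > 0`): there is a
probability measure `ν` with `P_p(E | 0 ↔ ∂ⁱⁿΛ(n)) → ν(E)` on cylinder events, and `ν`-a.s. for every finite edge set `S` the
configuration `ω ∖ S` has exactly one infinite cluster. [cite: BasuSapozhnikov2017ECP, Thm. 1.1] [cite: Kesten1986, Thm. (3)] -/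
theorem exists_iicMeasure_oneEnded_of_setToSetQuasiMultAspectAt (hd : 1 ≤ d) (p : unitInterval) (hp : 0 < (p : ℝ))
    (hθ : theta (zdGraph d) 0 p = 0) {s L : ℕ} (hs : 2 ≤ s) {ϰ : ℝ} (hϰ : 0 < ϰ) (hA2 : SetToSetQuasiMultAspectAt d p s L ϰ) :
    ∃ ν : Measure (BondConfig (Site d)), IsProbabilityMeasure ν ∧
      (∀ (F : Finset (Sym2 (Site d))) (E : Set (BondConfig (Site d))), MeasurableSet E → DeterminedBy E ↑F →
        Tendsto (fun n : ℕ => (bondPercolation (zdGraph d) p).real (E ∩ siteToBoundary d n) / oneArmProb d p n)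
          atTop (𝓝 (ν.real E))) ∧
      (∀ᵐ ω ∂ν, ∀ S : Finset (Sym2 (Site d)), numInfiniteClusters (ω \ ↑S) = 1) := by
  obtain ⟨ν, hνP, hν⟩ := exists_iicMeasure_of_kestenIICExistsAt hd p hp
    (kestenIICExistsAt_of_setToSetQuasiMultAspectAt hd p hp hθ hs hϰ hA2)
  exact ⟨ν, hνP, hν, iicMeasure_ae_numInfiniteClusters_sdiff_finset_eq_one hd p hp hθ (by omega) hϰ hA2 hν⟩

/-- **At `p_c(ℤ^d)`, `d ≥ 2`, under (A2)□ at aspect `(s,L)`** (`s ≥ 2`, `ϰ > 0`; `θ(p_c) = 0` by `CSH.percolationContinuity_allDimensions`):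
Kesten's IIC measure exists and its infinite cluster is one-ended. [cite: BasuSapozhnikov2017ECP, Thm. 1.1] [cite: Kesten1986, Thm. (3)] -/
theorem exists_iicMeasure_oneEnded_criticalProbI_of_setToSetQuasiMultAspectAt (hd : 2 ≤ d) {s L : ℕ} (hs : 2 ≤ s) {ϰ : ℝ}
    (hϰ : 0 < ϰ) (hA2 : SetToSetQuasiMultAspectAt d (criticalProbI d) s L ϰ) :
    ∃ ν : Measure (BondConfig (Site d)), IsProbabilityMeasure ν ∧
      (∀ (F : Finset (Sym2 (Site d))) (E : Set (BondConfig (Site d))), MeasurableSet E → DeterminedBy E ↑F →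
        Tendsto (fun n : ℕ => (bondPercolation (zdGraph d) (criticalProbI d)).real (E ∩ siteToBoundary d n) /
          oneArmProb d (criticalProbI d) n) atTop (𝓝 (ν.real E))) ∧
      (∀ᵐ ω ∂ν, ∀ S : Finset (Sym2 (Site d)), numInfiniteClusters (ω \ ↑S) = 1) := by
  have hpc : 0 < ((criticalProbI d : unitInterval) : ℝ) := by
    have h := Literature.Barriers.CriticalPhenomena.criticalProbI_pos' (d := d) (by omega)
    exact_mod_cast h
  exact exists_iicMeasure_oneEnded_of_setToSetQuasiMultAspectAt (by omega) (criticalProbI d) hpc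
    (CSH.percolationContinuity_allDimensions d hd) hs hϰ hA2

/-- **From the PRINTED hypothesis (A2)_ρ of Basu–Sapozhnikov** (`d ≥ 2`, `ϰ > 0`): `BasuSapozhnikovQM (zdGraph d) 0 p_c ϰ` gives (A2)□ at
aspect `(4d, 16d²)` (lead p222697), hence a one-ended Kesten IIC at `p_c(ℤ^d)`.
[cite: BasuSapozhnikov2017ECP, Thm. 1.1 and §1 assumption (A2)] [cite: Kesten1986, Thm. (3)] -/
theorem exists_iicMeasure_oneEnded_criticalProbI_of_basuSapozhnikovQM (hd : 2 ≤ d) {ϰ : ℝ} (hϰ : 0 < ϰ)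
    (hBS : BasuSapozhnikovQM (zdGraph d) (0 : Site d) (criticalProbI d) ϰ) :
    ∃ ν : Measure (BondConfig (Site d)), IsProbabilityMeasure ν ∧
      (∀ (F : Finset (Sym2 (Site d))) (E : Set (BondConfig (Site d))), MeasurableSet E → DeterminedBy E ↑F →
        Tendsto (fun n : ℕ => (bondPercolation (zdGraph d) (criticalProbI d)).real (E ∩ siteToBoundary d n) /
          oneArmProb d (criticalProbI d) n) atTop (𝓝 (ν.real E))) ∧
      (∀ᵐ ω ∂ν, ∀ S : Finset (Sym2 (Site d)), numInfiniteClusters (ω \ ↑S) = 1) :=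
  exists_iicMeasure_oneEnded_criticalProbI_of_setToSetQuasiMultAspectAt hd (s := 4 * d) (L := 4 * d * (4 * d)) (by omega)
    (by positivity) (setToSetQuasiMultAspectAt_of_basuSapozhnikovQM hd hϰ.le hBS)

/-! ## `ℤ³` -/

/-- **`ℤ³`: (A2)□ at `p_c(ℤ³)` (`Crossing.SetToSetQuasiMult`) ⇒ Kesten's IIC on `ℤ³` exists and is one-ended.**
[cite: BasuSapozhnikov2017ECP, Thm. 1.1] [cite: Kesten1986, Thm. (3)] -/
theorem exists_iicMeasure_oneEnded_of_setToSetQuasiMult (h : SetToSetQuasiMult) :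
    ∃ ν : Measure (BondConfig (Site 3)), IsProbabilityMeasure ν ∧
      (∀ (F : Finset (Sym2 (Site 3))) (E : Set (BondConfig (Site 3))), MeasurableSet E → DeterminedBy E ↑F →
        Tendsto (fun n : ℕ => (bondPercolation (zdGraph 3) (criticalProbI 3)).real (E ∩ siteToBoundary 3 n) /
          oneArmProb 3 (criticalProbI 3) n) atTop (𝓝 (ν.real E))) ∧
      (∀ᵐ ω ∂ν, ∀ S : Finset (Sym2 (Site 3)), numInfiniteClusters (ω \ ↑S) = 1) := by
  obtain ⟨ϰ, hϰ, hA2⟩ := h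
  exact exists_iicMeasure_oneEnded_criticalProbI_of_setToSetQuasiMultAspectAt (d := 3) (by norm_num) (s := 2) (L := 4) le_rfl hϰ
    (setToSetQuasiMultAt_iff_aspect.1 hA2)

/-! ## `ℤ²`, unconditionally -/

/-- **KESTEN'S IIC ON `ℤ²` IS ONE-ENDED — unconditionally**: for ANY probability measure `ν` with
`P_{1/2}(E | 0 ↔ ∂ⁱⁿΛ(n)) → ν(E)` on cylinder events (Kesten's IIC measure of bond percolation on `ℤ²`; it exists, `exists_iicMeasure_Z2`),
`ν`-a.s. for every finite edge set `S` the configuration `ω ∖ S` has exactly one infinite cluster.  Inputs: (A2)□(9,77) from RSW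
(p1 gen 6), Harris' `θ(1/2) = 0`, Kesten's `p_c(ℤ²) = 1/2` — all tree theorems. [cite: Kesten1986, Thm. (3)] -/
theorem iicMeasure_ae_oneEnded_Z2 {ν : Measure (BondConfig (Site 2))} [IsProbabilityMeasure ν]
    (hν : ∀ (F : Finset (Sym2 (Site 2))) (E : Set (BondConfig (Site 2))), MeasurableSet E → DeterminedBy E ↑F →
      Tendsto (fun n : ℕ => (bondPercolation (zdGraph 2) (criticalProbI 2)).real (E ∩ siteToBoundary 2 n) /
        oneArmProb 2 (criticalProbI 2) n) atTop (𝓝 (ν.real E))) :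
    ∀ᵐ ω ∂ν, ∀ S : Finset (Sym2 (Site 2)), numInfiniteClusters (ω \ ↑S) = 1 := by
  obtain ⟨ϰ, hϰ, hA2⟩ := exists_setToSetQuasiMultAspectAt_two_of_criticalProbI_le
  have hpc0 : 0 < ((criticalProbI 2 : unitInterval) : ℝ) := by
    rw [SubpolynomialBlocking.StubBlockProbTwoPos.criticalProbI_two_eq_half, coe_half]; norm_num
  have hθ : theta (zdGraph 2) (0 : Site 2) (criticalProbI 2) = 0 := by
    rw [SubpolynomialBlocking.StubBlockProbTwoPos.criticalProbI_two_eq_half]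
    exact harris_theta_half_holds
  exact iicMeasure_ae_numInfiniteClusters_sdiff_finset_eq_one (d := 2) (by norm_num) (criticalProbI 2) hpc0 hθ
    (s := 9) (L := 77) (by norm_num) hϰ (hA2 _ le_rfl) hν

/-- **KESTEN'S IIC MEASURE ON `ℤ²` — existence, both constructions, one infinite cluster, ONE END — unconditionally**: there is a
probability measure `ν` on bond configurations of `ℤ²` with `P_{1/2}(E | 0 ↔ ∂ⁱⁿΛ(n)) → ν(E)` (`n → ∞`) and
`P_p[E | {|C(0)| = ∞}] → ν(E)` (`p ↓ 1/2`) for every cylinder event `E`, `ν`-a.s. exactly one infinite cluster, and `ν`-a.s. for every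
finite edge set `S` exactly one infinite cluster of `ω ∖ S`. [cite: Kesten1986, Thm. (3)] -/
theorem exists_iicMeasure_oneEnded_Z2 :
    ∃ ν : Measure (BondConfig (Site 2)), IsProbabilityMeasure ν ∧
      (∀ (F : Finset (Sym2 (Site 2))) (E : Set (BondConfig (Site 2))), MeasurableSet E → DeterminedBy E ↑F →
        Tendsto (fun n : ℕ => (bondPercolation (zdGraph 2) (criticalProbI 2)).real (E ∩ siteToBoundary 2 n) /
          oneArmProb 2 (criticalProbI 2) n) atTop (𝓝 (ν.real E))) ∧
      (∀ (F : Finset (Sym2 (Site 2))) (E : Set (BondConfig (Site 2))), MeasurableSet E → DeterminedBy E ↑F →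
        Tendsto (fun p : unitInterval => ((bondPercolation (zdGraph 2) p)[|percolatesAt (0 : Site 2)]).real E)
          (𝓝[>] (criticalProbI 2)) (𝓝 (ν.real E))) ∧
      (∀ᵐ ω ∂ν, numInfiniteClusters ω = 1) ∧
      (∀ᵐ ω ∂ν, ∀ S : Finset (Sym2 (Site 2)), numInfiniteClusters (ω \ ↑S) = 1) := by
  obtain ⟨ν, hνP, h1, h2, h3⟩ := exists_iicMeasure_Z2
  exact ⟨ν, hνP, h1, h2, h3, iicMeasure_ae_oneEnded_Z2 h1⟩

end Summit.CriticalPhenomena.PercolationContinuityZ3.Theorems.Crossing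

end
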